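import Summits.BirchSwinnertonDyer.BirchSwinnertonDyer.Theorems.ClassRecordThreeEulerHalvesAtThreeCartanSupplyIsotypicKernel
import Summits.BirchSwinnertonDyer.BirchSwinnertonDyer.Theorems.ClassRecordThreeEulerHalvesAtThreeCartanTorusCubeCutTori
import HarnessLib

/-!
# SUPPLY from PERMUTATION MODELS, IV — the COSET `G`-SETS `G ∕ T_s`, `G ∕ T_C`: transitivity and `3 ∤ [G:T]` come for free

Helper file riding `--supports stmt-BirchSwinnertonDyer-19109` (crux `EulerHalvesAtThree`; UNREGISTERED sub-line `Cruxes/EulerHalvesAtThree/Lines/cartan_corr`,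
seat `bsd-idea-10` g12), continuing `…CartanSupplyPermModel` (p692372), `…PermSubmodule` (p693435), `…IsotypicKernel`. The `G`-set of the intended
permutation model is a COSET SPACE: `cosetPerm T : G →* Perm (Fin [G:T])` (transported from `G ∕ T` by `Nat.equivFinOfCardPos`) is TRANSITIVE
(`cosetPerm_trans`); the two tori of `GL₂(𝔽_q)` are subgroups (`splitTorusSub`, `centralizerSub η`) of orders `(q−1)²`, `(q−1)(q+1)` (from
`CartanTorusCubeCut.splitTorus_card ∕ nonsplitTorus_card`), `|GL₂(𝔽_q)| = (q²−1)(q²−q)` (`Matrix.card_GL_field`), so `[G:T_s] = q(q+1)`, `[G:T_C] = q(q−1)`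
(`index_splitTorusSub ∕ index_centralizerSub`) and `3 ∤ [G:T]` for `T = T_s`, `q ≡ 1 (3)` ∕ `T = T_C`, `q ≡ 2 (3)` (`three_not_dvd_index_split ∕ _centralizer`).
Hence `cartanTorusLatticeSupply_of_cosetSupply : CartanCosetSupply → CartanTorusLatticeSupply` (SUPPLY, the v11 stub of 23422's line `cartan`, BY NAME), where
`CartanCosetSupply` asks per prime `q ≠ 3` ONLY for the CHARACTER-THEORETIC CONTENT on the coset lattice `ℤ[G ∕ T]` (`T` by `q mod 3`): `Σ_g χ_W(g) = 0`, the trace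
identity `tr(g | ker A_{χ_W}) = χ_W(g)` («`W_q` occurs exactly once in `ℚ[G ∕ T]`», Frobenius reciprocity + the torus-fixed lines of `W_q`), `η`, and the two
torus-fixed lines of `ker A_{χ_W}` with generators. HONEST FRAMING: constructions and elementary counting; SUPPLY ∕ NUM ∕ (F2b♭) ∕ the cruxes are NOT proved;
BSD is proved for no curve. [folklore]
-/

set_option linter.dupNamespace false
set_option autoImplicit false

namespace Summit.BirchSwinnertonDyer.BirchSwinnertonDyer.Theorems.CartanSupply

open Summit.BirchSwinnertonDyer.BirchSwinnertonDyer.Theorems.CartanDegree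
open Summit.BirchSwinnertonDyer.BirchSwinnertonDyer.Theorems.CartanTorusCubeCut
open Summit.BirchSwinnertonDyer.BirchSwinnertonDyer.Theorems.CartanCorrespondence

/-! ## §1 The coset `G`-set `G ∕ T` as `Fin [G:T]` -/

section coset
variable {G : Type*} [Group G] [Finite G] (T : Subgroup G)

/-- PROVED: `[G:T] ≠ 0`. [folklore] -/
theorem card_quot_ne_zero : Nat.card (G ⧸ T) ≠ 0 := Nat.card_pos.ne'

/-- The numbering `G ∕ T ≃ Fin [G:T]`. -/
noncomputable def cosetEquiv : G ⧸ T ≃ Fin (Nat.card (G ⧸ T)) := Nat.equivFinOfCardPos (card_quot_ne_zero T)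

/-- The permutation action of `G` on `Fin [G:T]` transported from `G ∕ T`. -/
noncomputable def cosetPerm : G →* Equiv.Perm (Fin (Nat.card (G ⧸ T))) :=
  (cosetEquiv T).permCongrHom.toMonoidHom.comp (MulAction.toPermHom G (G ⧸ T))

/-- PROVED: unfolding. [folklore] -/
theorem cosetPerm_apply (g : G) (i : Fin (Nat.card (G ⧸ T))) : cosetPerm T g i = cosetEquiv T (g • (cosetEquiv T).symm i) := rfl

/-- PROVED: the coset action is transitive. [folklore] -/
theorem cosetPerm_trans (i j : Fin (Nat.card (G ⧸ T))) : ∃ g, cosetPerm T g i = j := by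
  obtain ⟨a, ha⟩ := QuotientGroup.mk_surjective ((cosetEquiv T).symm i)
  obtain ⟨b, hb⟩ := QuotientGroup.mk_surjective ((cosetEquiv T).symm j)
  refine ⟨b * a⁻¹, ?_⟩
  rw [cosetPerm_apply, ← ha, MulAction.Quotient.smul_coe, smul_eq_mul, inv_mul_cancel_right, hb, Equiv.apply_symm_apply]

omit [Finite G] in
/-- PROVED: `[G:T]·|T| = |G|`. [folklore] -/
theorem card_quot_mul_card : Nat.card (G ⧸ T) * Nat.card T = Nat.card G := T.index_mul_card

end coset

/-! ## §2 The two tori of `GL₂(𝔽_q)` as subgroups, their orders and indices -/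

variable {q : ℕ} [Fact q.Prime]

/-- The split torus `T_s` (diagonal matrices) as a subgroup. -/
def splitTorusSub (q : ℕ) [Fact q.Prime] : Subgroup (G q) where
  carrier := {g | (g : Mat q) 0 1 = 0 ∧ (g : Mat q) 1 0 = 0}
  mul_mem' := by
    intro g h hg hh
    simp only [Set.mem_setOf_eq, Units.val_mul, Matrix.mul_apply, Fin.sum_univ_two] at hg hh ⊢
    rw [hg.1, hh.1, hg.2, hh.2]
    simp
  one_mem' := by
    simp only [Set.mem_setOf_eq, Units.val_one]
    exact ⟨Matrix.one_apply_ne (by decide), Matrix.one_apply_ne (by decide)⟩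
  inv_mem' := by
    intro g hg
    simp only [Set.mem_setOf_eq] at hg ⊢
    have hd : (g : Mat q).det ≠ 0 := Matrix.GeneralLinearGroup.det_ne_zero g
    rw [Matrix.det_fin_two, hg.1, zero_mul, sub_zero] at hd
    have h00 : (g : Mat q) 0 0 ≠ 0 := left_ne_zero_of_mul hd
    have e1 := congrArg (fun M : Mat q => M 0 1) (Units.mul_inv g)
    have e2 := congrArg (fun M : Mat q => M 1 0) (Units.inv_mul g)
    simp only [Matrix.mul_apply, Fin.sum_univ_two, Matrix.one_apply_ne (by decide : (0 : Fin 2) ≠ 1),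
      Matrix.one_apply_ne (by decide : (1 : Fin 2) ≠ 0), hg.1, hg.2, zero_mul, mul_zero, add_zero] at e1 e2
    exact ⟨(mul_eq_zero.mp e1).resolve_left h00, (mul_eq_zero.mp e2).resolve_right h00⟩

/-- The centraliser torus `T_C = C(η)` as a subgroup. -/
def centralizerSub (η : Mat q) : Subgroup (G q) where
  carrier := {g | (g : Mat q) * η = η * g}
  mul_mem' := by
    intro g h hg hh
    simp only [Set.mem_setOf_eq, Units.val_mul] at hg hh ⊢
    rw [mul_assoc, hh, ← mul_assoc, hg, mul_assoc]
  one_mem' := by simp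
  inv_mem' := by
    intro g hg
    simp only [Set.mem_setOf_eq] at hg ⊢
    calc ((g⁻¹ : G q) : Mat q) * η = (g⁻¹ : G q) * η * ((g : Mat q) * (g⁻¹ : G q)) := by rw [Units.mul_inv, mul_one]
      _ = (g⁻¹ : G q) * ((g : Mat q) * η) * (g⁻¹ : G q) := by rw [hg]; simp only [mul_assoc]
      _ = η * (g⁻¹ : G q) := by rw [← mul_assoc, Units.inv_mul, one_mul]

/-- PROVED: `|T_s| = (q − 1)²` (from `splitTorus_card`). [folklore] -/
theorem card_splitTorusSub : Nat.card (splitTorusSub q) = (q - 1) ^ 2 := by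
  rw [← splitTorus_card (q := q)]
  exact Nat.subtype_card (splitTorus q) (fun g => by
    show g ∈ splitTorus q ↔ ((g : Mat q) 0 1 = 0 ∧ (g : Mat q) 1 0 = 0)
    simp [splitTorus])

/-- PROVED: `|T_C| = (q − 1)(q + 1)` (from `nonsplitTorus_card`). [folklore] -/
theorem card_centralizerSub {η : Mat q} (hη : ¬ HasRatEigenvalue η) : Nat.card (centralizerSub η) = (q - 1) * (q + 1) := by
  rw [← nonsplitTorus_card hη]
  exact Nat.subtype_card (nonsplitTorus η) (fun g => by
    show g ∈ nonsplitTorus η ↔ (g : Mat q) * η = η * g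
    simp [nonsplitTorus])

/-- PROVED: `|GL₂(𝔽_q)| = (q² − 1)(q² − q)`. [folklore] -/
theorem card_G : Nat.card (G q) = (q ^ 2 - 1) * (q ^ 2 - q) := by
  rw [Matrix.card_GL_field, Fin.prod_univ_two, ZMod.card]
  simp

/-- PROVED: `[G : T_s] = q(q + 1)`. [folklore] -/
theorem index_splitTorusSub : Nat.card (G q ⧸ splitTorusSub q) = q * (q + 1) := by
  have h := card_quot_mul_card (splitTorusSub q)
  rw [card_splitTorusSub, card_G] at h
  have hq : 2 ≤ q := (Fact.out : q.Prime).two_le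
  obtain ⟨k, rfl⟩ := Nat.exists_eq_add_of_le hq
  have h' : Nat.card (G (2 + k) ⧸ splitTorusSub (2 + k)) * (k + 1) ^ 2 = ((2 + k) * (k + 3)) * (k + 1) ^ 2 := by
    rw [show 2 + k - 1 = k + 1 from by omega] at h
    rw [h]
    have e1 : (2 + k) ^ 2 - 1 = (k + 1) * (k + 3) := by
      rw [show (2 + k) ^ 2 = (k + 1) * (k + 3) + 1 from by ring]; omega
    have e2 : (2 + k) ^ 2 - (2 + k) = (k + 1) * (2 + k) := by
      rw [show (2 + k) ^ 2 = (k + 1) * (2 + k) + (2 + k) from by ring]; omega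
    rw [e1, e2]; ring
  have hpos : (k + 1) ^ 2 ≠ 0 := by positivity
  have := Nat.eq_of_mul_eq_mul_right (Nat.pos_of_ne_zero hpos) h'
  rw [this]; ring

/-- PROVED: `[G : T_C] = q(q − 1)`. [folklore] -/
theorem index_centralizerSub {η : Mat q} (hη : ¬ HasRatEigenvalue η) : Nat.card (G q ⧸ centralizerSub η) = q * (q - 1) := by
  have h := card_quot_mul_card (centralizerSub η)
  rw [card_centralizerSub hη, card_G] at h
  have hq : 2 ≤ q := (Fact.out : q.Prime).two_le
  obtain ⟨k, rfl⟩ := Nat.exists_eq_add_of_le hq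
  have h' : Nat.card (G (2 + k) ⧸ centralizerSub η) * ((k + 1) * (k + 3)) = ((2 + k) * (k + 1)) * ((k + 1) * (k + 3)) := by
    rw [show 2 + k - 1 = k + 1 from by omega, show 2 + k + 1 = k + 3 from by omega] at h
    rw [h]
    have e1 : (2 + k) ^ 2 - 1 = (k + 1) * (k + 3) := by
      rw [show (2 + k) ^ 2 = (k + 1) * (k + 3) + 1 from by ring]; omega
    have e2 : (2 + k) ^ 2 - (2 + k) = (k + 1) * (2 + k) := by
      rw [show (2 + k) ^ 2 = (k + 1) * (2 + k) + (2 + k) from by ring]; omega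
    rw [e1, e2]; ring
  have hpos : (k + 1) * (k + 3) ≠ 0 := by positivity
  have := Nat.eq_of_mul_eq_mul_right (Nat.pos_of_ne_zero hpos) h'
  rw [this, show 2 + k - 1 = k + 1 from by omega]

/-- PROVED: `3 ∤ [G : T_s]` for `q ≡ 1 (mod 3)`. [folklore] -/
theorem three_not_dvd_index_split (h1 : q % 3 = 1) : ¬ 3 ∣ Nat.card (G q ⧸ splitTorusSub q) := by
  rw [index_splitTorusSub]; intro h; have := Nat.mod_eq_zero_of_dvd h; rw [Nat.mul_mod, Nat.add_mod, h1] at this; norm_num at this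

/-- PROVED: `3 ∤ [G : T_C]` for `q ≡ 2 (mod 3)`. [folklore] -/
theorem three_not_dvd_index_centralizer {η : Mat q} (hη : ¬ HasRatEigenvalue η) (h2 : q % 3 = 2) :
    ¬ 3 ∣ Nat.card (G q ⧸ centralizerSub η) := by
  rw [index_centralizerSub hη]; intro h; have := Nat.mod_eq_zero_of_dvd h
  have hq : 2 ≤ q := (Fact.out : q.Prime).two_le
  obtain ⟨k, rfl⟩ := Nat.exists_eq_add_of_le hq
  rw [show 2 + k - 1 = k + 1 from by omega] at this; rw [Nat.add_mod] at h2
  have hk : k % 3 = 0 := by omega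
  rw [Nat.mul_mod, Nat.add_mod 2 k, Nat.add_mod k 1, hk] at this; norm_num at this

/-! ## §3 Coset data and SUPPLY by name -/

/-- A SPLIT COSET DATUM at `q ≡ 1 (mod 3)`: the character-theoretic content on `ℤ[G ∕ T_s]`. -/
structure CartanSplitCosetDatum (q : ℕ) [Fact q.Prime] where
  mod_three : q % 3 = 1
  /-- `⟨χ_W, 𝟙⟩ = 0`. -/
  sum_char : ∑ g : G q, cubicNewvectorChar q g = 0
  /-- traces of the action on the isotypic kernel `= χ_{W_q}` (`W_q` once in `ℚ[G ∕ T_s]`). -/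
  trace_eq : ∀ g, LinearMap.trace ℤ (LinearMap.ker (isotypicOp (cosetPerm (splitTorusSub q)) (cubicNewvectorChar q)))
    ((permAct (cosetPerm (splitTorusSub q)) g).restrict (ker_isotypicOp_stable (cosetPerm (splitTorusSub q)) g)) = cubicNewvectorChar q g
  /-- the non-split torus `𝔽_q[η]^×`. -/
  η : Mat q
  η_irred : ¬ HasRatEigenvalue η
  /-- generators of the two torus-fixed lines of the kernel. -/
  φS : Fin (Nat.card (G q ⧸ splitTorusSub q)) → ℤ
  φC : Fin (Nat.card (G q ⧸ splitTorusSub q)) → ℤ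
  φS_mem : isotypicOp (cosetPerm (splitTorusSub q)) (cubicNewvectorChar q) φS = 0
  φC_mem : isotypicOp (cosetPerm (splitTorusSub q)) (cubicNewvectorChar q) φC = 0
  φS_fixed : ∀ g : G q, (g : Mat q) 0 1 = 0 → (g : Mat q) 1 0 = 0 → permAct (cosetPerm (splitTorusSub q)) g φS = φS
  φC_fixed : ∀ g : G q, (g : Mat q) * η = η * g → permAct (cosetPerm (splitTorusSub q)) g φC = φC
  φS_gen : ∀ φ : Fin (Nat.card (G q ⧸ splitTorusSub q)) → ℤ, isotypicOp (cosetPerm (splitTorusSub q)) (cubicNewvectorChar q) φ = 0 →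
    (∀ g : G q, (g : Mat q) 0 1 = 0 → (g : Mat q) 1 0 = 0 → permAct (cosetPerm (splitTorusSub q)) g φ = φ) → ∃ m : ℤ, φ = m • φS
  φC_gen : ∀ φ : Fin (Nat.card (G q ⧸ splitTorusSub q)) → ℤ, isotypicOp (cosetPerm (splitTorusSub q)) (cubicNewvectorChar q) φ = 0 →
    (∀ g : G q, (g : Mat q) * η = η * g → permAct (cosetPerm (splitTorusSub q)) g φ = φ) → ∃ m : ℤ, φ = m • φC
  φS_ne : φS ≠ 0
  φC_ne : φC ≠ 0

/-- A NON-SPLIT COSET DATUM at `q ≡ 2 (mod 3)`: the character-theoretic content on `ℤ[G ∕ T_C]`, `T_C = C(η)`. -/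
structure CartanNonsplitCosetDatum (q : ℕ) [Fact q.Prime] where
  mod_three : q % 3 = 2
  /-- the non-split torus `𝔽_q[η]^×`. -/
  η : Mat q
  η_irred : ¬ HasRatEigenvalue η
  /-- `⟨χ_W, 𝟙⟩ = 0`. -/
  sum_char : ∑ g : G q, cubicNewvectorChar q g = 0
  /-- traces of the action on the isotypic kernel `= χ_{W_q}` (`W_q` once in `ℚ[G ∕ T_C]`). -/
  trace_eq : ∀ g, LinearMap.trace ℤ (LinearMap.ker (isotypicOp (cosetPerm (centralizerSub η)) (cubicNewvectorChar q)))
    ((permAct (cosetPerm (centralizerSub η)) g).restrict (ker_isotypicOp_stable (cosetPerm (centralizerSub η)) g)) = cubicNewvectorChar q g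
  /-- generators of the two torus-fixed lines of the kernel. -/
  φS : Fin (Nat.card (G q ⧸ centralizerSub η)) → ℤ
  φC : Fin (Nat.card (G q ⧸ centralizerSub η)) → ℤ
  φS_mem : isotypicOp (cosetPerm (centralizerSub η)) (cubicNewvectorChar q) φS = 0
  φC_mem : isotypicOp (cosetPerm (centralizerSub η)) (cubicNewvectorChar q) φC = 0
  φS_fixed : ∀ g : G q, (g : Mat q) 0 1 = 0 → (g : Mat q) 1 0 = 0 → permAct (cosetPerm (centralizerSub η)) g φS = φS
  φC_fixed : ∀ g : G q, (g : Mat q) * η = η * g → permAct (cosetPerm (centralizerSub η)) g φC = φC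
  φS_gen : ∀ φ : Fin (Nat.card (G q ⧸ centralizerSub η)) → ℤ, isotypicOp (cosetPerm (centralizerSub η)) (cubicNewvectorChar q) φ = 0 →
    (∀ g : G q, (g : Mat q) 0 1 = 0 → (g : Mat q) 1 0 = 0 → permAct (cosetPerm (centralizerSub η)) g φ = φ) → ∃ m : ℤ, φ = m • φS
  φC_gen : ∀ φ : Fin (Nat.card (G q ⧸ centralizerSub η)) → ℤ, isotypicOp (cosetPerm (centralizerSub η)) (cubicNewvectorChar q) φ = 0 →
    (∀ g : G q, (g : Mat q) * η = η * g → permAct (cosetPerm (centralizerSub η)) g φ = φ) → ∃ m : ℤ, φ = m • φC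
  φS_ne : φS ≠ 0
  φC_ne : φC ≠ 0

/-- **COSET SUPPLY**: every prime `q ≠ 3` carries the coset datum of its residue class mod 3. [folklore] -/
@[conjecture]
def CartanCosetSupply : Prop := ∀ q : ℕ, ∀ _hq : Fact q.Prime, q ≠ 3 →
  (q % 3 = 1 → Nonempty (CartanSplitCosetDatum q)) ∧ (q % 3 = 2 → Nonempty (CartanNonsplitCosetDatum q))

/-- PROVED — one prime at a time, split case: a split coset datum gives the `q`-instance of SUPPLY (`G`-set, transitivity, `3 ∤ n`, lattice, form, mod-3,
basis, transport all supplied by the chain `cosetPerm → CartanIsotypicKernelDatum → CartanPermSubmodule → CartanPermModel → CartanTorusLattice`). [folklore] -/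
theorem cartanTorusLatticeSupplyAt_of_splitCoset (D : CartanSplitCosetDatum q) :
    ∃ (𝓛 : CartanTorusLattice q) (wS wC : Fin 𝓛.d → ℤ),
      𝓛.IsSplitFixed wS ∧ 𝓛.IsNonsplitFixed wC ∧
      (∀ v, 𝓛.IsSplitFixed v → ∃ m : ℤ, v = m • wS) ∧ (∀ v, 𝓛.IsNonsplitFixed v → ∃ m : ℤ, v = m • wC) ∧ wS ≠ 0 ∧ wC ≠ 0 :=
  cartanTorusLatticeSupplyAt_of_isotypicKernel
    { n := Nat.card (G q ⧸ splitTorusSub q), σ := cosetPerm (splitTorusSub q), σ_trans := cosetPerm_trans (splitTorusSub q),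
      three_not_dvd := three_not_dvd_index_split D.mod_three, sum_char := D.sum_char, trace_eq := D.trace_eq, η := D.η, η_irred := D.η_irred,
      φS := D.φS, φC := D.φC, φS_mem := D.φS_mem, φC_mem := D.φC_mem, φS_fixed := D.φS_fixed, φC_fixed := D.φC_fixed,
      φS_gen := D.φS_gen, φC_gen := D.φC_gen, φS_ne := D.φS_ne, φC_ne := D.φC_ne }

/-- PROVED — one prime at a time, non-split case. [folklore] -/
theorem cartanTorusLatticeSupplyAt_of_nonsplitCoset (D : CartanNonsplitCosetDatum q) :
    ∃ (𝓛 : CartanTorusLattice q) (wS wC : Fin 𝓛.d → ℤ),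
      𝓛.IsSplitFixed wS ∧ 𝓛.IsNonsplitFixed wC ∧
      (∀ v, 𝓛.IsSplitFixed v → ∃ m : ℤ, v = m • wS) ∧ (∀ v, 𝓛.IsNonsplitFixed v → ∃ m : ℤ, v = m • wC) ∧ wS ≠ 0 ∧ wC ≠ 0 :=
  cartanTorusLatticeSupplyAt_of_isotypicKernel
    { n := Nat.card (G q ⧸ centralizerSub D.η), σ := cosetPerm (centralizerSub D.η), σ_trans := cosetPerm_trans (centralizerSub D.η),
      three_not_dvd := three_not_dvd_index_centralizer D.η_irred D.mod_three, sum_char := D.sum_char, trace_eq := D.trace_eq, η := D.η,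
      η_irred := D.η_irred, φS := D.φS, φC := D.φC, φS_mem := D.φS_mem, φC_mem := D.φC_mem, φS_fixed := D.φS_fixed, φC_fixed := D.φC_fixed,
      φS_gen := D.φS_gen, φC_gen := D.φC_gen, φS_ne := D.φS_ne, φC_ne := D.φC_ne }

/-- PROVED: a prime `q ≠ 3` is `≡ 1` or `≡ 2 (mod 3)`. [folklore] -/
theorem prime_mod_three {q : ℕ} (hq : q.Prime) (h3 : q ≠ 3) : q % 3 = 1 ∨ q % 3 = 2 := by
  have h : q % 3 ≠ 0 := by
    intro h0
    have h3d : 3 ∣ q := Nat.dvd_of_mod_eq_zero h0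
    rcases (Nat.dvd_prime hq).mp h3d with h | h
    · norm_num at h
    · exact h3 h.symm
  omega

omit [Fact q.Prime] in
/-- PROVED — **SUPPLY ⟸ COSET SUPPLY** (`CartanTorusLatticeSupply` BY NAME). [folklore] -/
theorem cartanTorusLatticeSupply_of_cosetSupply (h : CartanCosetSupply) : CartanTorusLatticeSupply := by
  intro q hq h3
  haveI : Fact q.Prime := ⟨hq⟩
  rcases prime_mod_three hq h3 with h1 | h2
  · exact ((h q ⟨hq⟩ h3).1 h1).elim fun D => cartanTorusLatticeSupplyAt_of_splitCoset D
  · exact ((h q ⟨hq⟩ h3).2 h2).elim fun D => cartanTorusLatticeSupplyAt_of_nonsplitCoset D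

end Summit.BirchSwinnertonDyer.BirchSwinnertonDyer.Theorems.CartanSupply
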